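import Literature.Barriers.CriticalPhenomena.TimarLevelGrid
import Literature.Barriers.CriticalPhenomena.TimarHeavyClustersErgodic
import HarnessLib

/-!
# Timár 2006, §5 (set-up): slabs of arbitrary position, their separating property, monotone
# long-edge paths, and bookkeeping for heavy sets — PROVED

Barrier catalogue `Literature/Barriers/CriticalPhenomena/`; a deterministic brick of the programme
proving Timár's Thm. 5.5 (`Timar2006_finiteLevelUnion`, `TimarCriticalNonunimodular.lean`), on top
of the §2 vocabulary of `TimarNonunimodularLevels.lean` (weights `w = autWeight G o`, levels,
"above", heavy sets) and the §4 grid of `TimarLevelGrid.lean` (`Δ = minNbrWeight G o`, the least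
weight of a neighbour of `o`; `Δ w(x) ≤ w(y)` along every edge; long edges). Á. Timár,
*Percolation on nonunimodular transitive graphs*, Ann. Probab. 34 (2006) 2344–2364, §5:

> "Let `μ` be the maximum of `w(x)/w(y)`, where `x` and `y` are adjacent vertices in `G`. …
> We shall call a set of the form `L = {x : μ^a < w(x) ≤ μ^b}` a *slab* if `a, b ∈ ℝ` and
> `b - a ≥ 1`. … It is clear that a slab separates the levels below it from the levels above it."

Timár's `μ` is `Δ⁻¹` (the edge ratios form a set closed under inversion, and `Δ` is the least of
them, `minNbrWeight_mul_le_of_adj`), so a slab "of width `≥ 1`" is a weight window `(a, b]` with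
`a ≤ Δ b`. Everything here is PROVED, for `G` connected, locally finite, transitive
(`IsGraphTransitive`) and nonunimodular:

* `weightSlab G o a b = {v : a < w(v) ≤ b}` for arbitrary `a b : ℝ≥0∞` (the grid slab
  `slab G o j` of `TimarLevelGrid.lean` is `weightSlab G o (Δ^(j+1)) (Δ^j)`, `slab_eq_weightSlab`)
  and the **separation property** for `a ≤ Δ b`: a walk from a vertex of weight `> b` to a vertex
  of weight `≤ b` visits the slab (`exists_mem_weightSlab_of_walk`), so a walk avoiding the slab
  stays above it or stays below it (`lt_autWeight_of_walk_avoiding`, `autWeight_le_of_walk_avoiding`);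
* **monotone long-edge sequences**: from every vertex an infinite sequence of neighbours going
  down by exactly the factor `Δ` at each step (`exists_downSeq`, weights `Δ^n w(x)`, reaching below
  any positive weight) and one going up by exactly `Δ⁻¹` (`exists_upSeq`, reaching above any finite
  weight); both are injective with strictly monotone weights — the paths "down to a lower level" /
  "up to a higher level" used in the proofs of Lemma 5.2 and Cor. 5.10;
* bookkeeping for total weights used by the §5 lemmas: monotonicity and subadditivity of
  `setWeight`, "a heavy set covered by a finite set and finitely many further sets has a heavy
  piece" (`IsHeavy.exists_isHeavy_inter`); invariance of heaviness under automorphisms is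
  `isHeavy_image_iff` of `TimarHeavyClustersErgodic.lean` (imported).

## References

* Á. Timár, Ann. Probab. 34 (2006) 2344–2364 (arXiv:math/0702875), §5: `μ` (first paragraph),
  slabs and their separating property (after Lemma 5.1), proof of Lemma 5.2; §2 (heavy clusters);
  §4 (long edges, `Δ`). [Timar2006]
* R. Lyons, Y. Peres, *Probability on Trees and Networks*, CUP 2016, §8.2 (weights `μ_x`, (8.7)).
  [LyonsPeres2016]
-/

noncomputable section

namespace Literature.Barriers.CriticalPhenomena

open _root_.Filter
open scoped ENNReal

variable {V : Type*}

/-! ### Weights under automorphisms -/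

/-- The weights based at `γ o` of `γ y` equal the weights based at `o` of `y`. [folklore] -/
theorem autWeight_map_map {G : SimpleGraph V} (γ : G ≃g G) (o y : V) :
    autWeight G (γ o) (γ y) = autWeight G o y := by
  rw [autWeight, autWeight, encard_stabilizerOrbit_map, encard_stabilizerOrbit_map]

/-- The ratio `w_o(y) / w_o(x)` is the weight of `y` based at `x` ("this definition is independent
of the choice of `o` up to a constant factor", Timár 2006, §2).
[cite: Timar2006, §2 (weights independent of o up to a constant factor)] -/
theorem autWeight_div_eq_autWeight (G : SimpleGraph V) [G.LocallyFinite] (hconn : G.Connected)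
    (o x y : V) : autWeight G o y / autWeight G o x = autWeight G x y := by
  rw [eq_comm, ENNReal.eq_div_iff (autWeight_ne_zero G hconn o x) (autWeight_ne_top G hconn o x),
    mul_comm]
  exact autWeight_base_mul G hconn o x y

/-- `w(γ v) = w(γ o) · w(v)` for weights based at `o` ("any automorphism of `G` acts on the
weights of the levels by multiplying them with a constant", Timár 2006, §5).
[cite: Timar2006, §5 (automorphisms act on weights by a constant factor)] -/
theorem autWeight_map_eq_mul (G : SimpleGraph V) [G.LocallyFinite] (hconn : G.Connected)
    (γ : G ≃g G) (o v : V) : autWeight G o (γ v) = autWeight G o (γ o) * autWeight G o v := by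
  have h := autWeight_map_mul G hconn γ o v o
  rwa [autWeight_self G hconn o, mul_one] at h

/-! ### Slabs of arbitrary position and the separation property -/

/-- A **slab** `{v : a < w(v) ≤ b}` of weights based at `o` (Timár 2006, §5: "a set of the form
`L = {x : μ^a < w(x) ≤ μ^b}`"; the width condition "`b - a ≥ 1`", here `a ≤ Δ b`, is imposed
where it is used). [cite: Timar2006, §5 (slabs)] -/
def weightSlab (G : SimpleGraph V) (o : V) (a b : ℝ≥0∞) : Set V :=
  {v | a < autWeight G o v ∧ autWeight G o v ≤ b}

/-- Membership in a slab. [cite: Timar2006, §5 (slabs)] -/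
@[simp] theorem mem_weightSlab {G : SimpleGraph V} {o : V} {a b : ℝ≥0∞} {v : V} :
    v ∈ weightSlab G o a b ↔ a < autWeight G o v ∧ autWeight G o v ≤ b := Iff.rfl

/-- The grid slabs `G(ℓ_{j+1}, ℓ_j]` of `TimarLevelGrid.lean` are the slabs `(Δ^(j+1), Δ^j]`.
[cite: Timar2006, §5 ("Every separating set of levels … is a slab")] -/
theorem slab_eq_weightSlab (G : SimpleGraph V) [G.LocallyFinite] (o : V) (j : ℕ) :
    slab G o j = weightSlab G o (minNbrWeight G o ^ (j + 1)) (minNbrWeight G o ^ j) := rfl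

/-- Slabs are unions of levels: vertices on a common level lie in the same slabs ("the
1-partition of `G` also partitions its levels", Timár 2006, §5). [cite: Timar2006, §5 (slabs and levels)] -/
theorem mem_weightSlab_iff_of_sameLevel {G : SimpleGraph V} [G.LocallyFinite] (hconn : G.Connected)
    {o : V} {a b : ℝ≥0∞} {u v : V} (h : SameLevel G u v) :
    u ∈ weightSlab G o a b ↔ v ∈ weightSlab G o a b := by
  rw [mem_weightSlab, mem_weightSlab, (sameLevel_iff_autWeight_eq G hconn o u v).1 h]

/-- **A slab separates the levels below it from the levels above it** (Timár 2006, §5): if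
`a ≤ Δ b`, every walk from a vertex of weight `> b` to a vertex of weight `≤ b` visits the slab
`(a, b]` — its first vertex of weight `≤ b` is entered along an edge, across which the weight
drops by at most the factor `Δ`.
[cite: Timar2006, §5 ("a slab separates the levels below it from the levels above it")] -/
theorem exists_mem_weightSlab_of_walk {G : SimpleGraph V} [G.LocallyFinite] (hconn : G.Connected)
    (ht : IsGraphTransitive G) (hU : ¬ IsGraphUnimodular G) {o : V} {a b : ℝ≥0∞}
    (hab : a ≤ minNbrWeight G o * b) :
    ∀ {u v : V} (p : G.Walk u v), b < autWeight G o u → autWeight G o v ≤ b →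
      ∃ z ∈ p.support, z ∈ weightSlab G o a b
  | _, _, .nil, hu, hv => absurd hv (not_le.2 hu)
  | u, v, .cons (v := u') hadj q, hu, hv => by
    by_cases hu' : autWeight G o u' ≤ b
    · refine ⟨u', by simp, ?_, hu'⟩
      calc a ≤ minNbrWeight G o * b := hab
        _ < minNbrWeight G o * autWeight G o u :=
            ENNReal.mul_lt_mul_right (minNbrWeight_ne_zero hconn o)
              (minNbrWeight_ne_top hconn ht hU o) hu
        _ ≤ autWeight G o u' := minNbrWeight_mul_le_of_adj hconn ht o hadj
    · obtain ⟨z, hz, hzs⟩ := exists_mem_weightSlab_of_walk hconn ht hU hab q (not_le.1 hu') hv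
      exact ⟨z, by simp [hz], hzs⟩

/-- A walk avoiding a slab `(a, b]` with `a ≤ Δ b` that starts above it ends above it.
[cite: Timar2006, §5 ("a slab separates the levels below it from the levels above it")] -/
theorem lt_autWeight_of_walk_avoiding {G : SimpleGraph V} [G.LocallyFinite]
    (hconn : G.Connected) (ht : IsGraphTransitive G) (hU : ¬ IsGraphUnimodular G) {o : V}
    {a b : ℝ≥0∞} (hab : a ≤ minNbrWeight G o * b) {u v : V} (p : G.Walk u v)
    (hp : ∀ z ∈ p.support, z ∉ weightSlab G o a b) (hu : b < autWeight G o u) :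
    b < autWeight G o v := by
  by_contra hv
  obtain ⟨z, hz, hzs⟩ := exists_mem_weightSlab_of_walk hconn ht hU hab p hu (not_lt.1 hv)
  exact hp z hz hzs

/-- A walk avoiding a slab `(a, b]` with `a ≤ Δ b` that starts below it ends below it.
[cite: Timar2006, §5 ("a slab separates the levels below it from the levels above it")] -/
theorem autWeight_le_of_walk_avoiding {G : SimpleGraph V} [G.LocallyFinite]
    (hconn : G.Connected) (ht : IsGraphTransitive G) (hU : ¬ IsGraphUnimodular G) {o : V}
    {a b : ℝ≥0∞} (hab : a ≤ minNbrWeight G o * b) {u v : V} (p : G.Walk u v)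
    (hp : ∀ z ∈ p.support, z ∉ weightSlab G o a b) (hu : autWeight G o u ≤ a) :
    autWeight G o v ≤ a := by
  have hv : v ∉ weightSlab G o a b := hp v p.end_mem_support
  rw [mem_weightSlab, not_and_or, not_lt, not_le] at hv
  rcases hv with hv | hv
  · exact hv
  · -- `b < w(v)`: walking back from `v` we would stay above `b`, contradicting `w(u) ≤ a ≤ b`
    have hab' : a ≤ b :=
      hab.trans (mul_le_of_le_one_left' (minNbrWeight_lt_one hconn ht hU o).le)
    have hu' := lt_autWeight_of_walk_avoiding hconn ht hU hab p.reverse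
      (fun z hz => hp z (by simpa using hz)) hv
    exact absurd (hu'.trans_le hu) (not_lt.2 hab')

/-! ### Monotone long-edge sequences -/

/-- **From every vertex there is an infinite sequence of neighbours going down by the factor
`Δ` at each step** (iterate the long edges `exists_adj_autWeight_eq_mul`).
[cite: Timar2006, §4 and §5 (long edges; paths down to lower levels)] -/
theorem exists_downSeq {G : SimpleGraph V} [G.LocallyFinite] (hconn : G.Connected)
    (ht : IsGraphTransitive G) (hU : ¬ IsGraphUnimodular G) (o x : V) :
    ∃ u : ℕ → V, u 0 = x ∧ ∀ n, G.Adj (u n) (u (n + 1)) ∧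
      autWeight G o (u (n + 1)) = minNbrWeight G o * autWeight G o (u n) := by
  choose f hf using fun v => exists_adj_autWeight_eq_mul hconn ht hU o v
  refine ⟨fun n => f^[n] x, rfl, fun n => ?_⟩
  simp only [Function.iterate_succ_apply']
  exact hf _

/-- **… and one going up by the factor `Δ⁻¹` at each step** (`exists_adj_mul_autWeight_eq`).
[cite: Timar2006, §4 and §5 (long edges; paths up to higher levels)] -/
theorem exists_upSeq {G : SimpleGraph V} [G.LocallyFinite] (hconn : G.Connected)
    (ht : IsGraphTransitive G) (hU : ¬ IsGraphUnimodular G) (o x : V) :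
    ∃ u : ℕ → V, u 0 = x ∧ ∀ n, G.Adj (u n) (u (n + 1)) ∧
      minNbrWeight G o * autWeight G o (u (n + 1)) = autWeight G o (u n) := by
  choose f hf using fun v => exists_adj_mul_autWeight_eq hconn ht hU o v
  refine ⟨fun n => f^[n] x, rfl, fun n => ?_⟩
  simp only [Function.iterate_succ_apply']
  exact hf _

/-- Along a down-sequence the weights are `w(u n) = Δ^n · w(u 0)`. [folklore] -/
theorem autWeight_downSeq {G : SimpleGraph V} [G.LocallyFinite] {o : V} {u : ℕ → V}
    (hu : ∀ n, G.Adj (u n) (u (n + 1)) ∧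
      autWeight G o (u (n + 1)) = minNbrWeight G o * autWeight G o (u n)) (n : ℕ) :
    autWeight G o (u n) = minNbrWeight G o ^ n * autWeight G o (u 0) := by
  induction n with
  | zero => simp
  | succ n ih => rw [(hu n).2, ih, pow_succ]; ring

/-- Along an up-sequence the weights satisfy `Δ^n · w(u n) = w(u 0)`. [folklore] -/
theorem pow_mul_autWeight_upSeq {G : SimpleGraph V} [G.LocallyFinite] {o : V} {u : ℕ → V}
    (hu : ∀ n, G.Adj (u n) (u (n + 1)) ∧
      minNbrWeight G o * autWeight G o (u (n + 1)) = autWeight G o (u n)) (n : ℕ) :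
    minNbrWeight G o ^ n * autWeight G o (u n) = autWeight G o (u 0) := by
  induction n with
  | zero => simp
  | succ n ih => rw [← ih, ← (hu n).2, pow_succ]; ring

/-- A down-sequence is strictly decreasing in weight: `m < n → w(u n) < w(u m)`. [folklore] -/
theorem autWeight_downSeq_lt {G : SimpleGraph V} [G.LocallyFinite] (hconn : G.Connected)
    (ht : IsGraphTransitive G) (hU : ¬ IsGraphUnimodular G) {o : V} {u : ℕ → V}
    (hu : ∀ n, G.Adj (u n) (u (n + 1)) ∧
      autWeight G o (u (n + 1)) = minNbrWeight G o * autWeight G o (u n)) {m n : ℕ} (hmn : m < n) :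
    autWeight G o (u n) < autWeight G o (u m) := by
  rw [autWeight_downSeq hu n, autWeight_downSeq hu m]
  exact ENNReal.mul_lt_mul_left (autWeight_ne_zero G hconn o (u 0)) (autWeight_ne_top G hconn o (u 0))
    (minNbrWeight_pow_lt_pow hconn ht hU o hmn)

/-- An up-sequence is strictly increasing in weight: `m < n → w(u m) < w(u n)`. [folklore] -/
theorem autWeight_upSeq_lt {G : SimpleGraph V} [G.LocallyFinite] (hconn : G.Connected)
    (ht : IsGraphTransitive G) (hU : ¬ IsGraphUnimodular G) {o : V} {u : ℕ → V}
    (hu : ∀ n, G.Adj (u n) (u (n + 1)) ∧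
      minNbrWeight G o * autWeight G o (u (n + 1)) = autWeight G o (u n)) {m n : ℕ} (hmn : m < n) :
    autWeight G o (u m) < autWeight G o (u n) := by
  have h0 : minNbrWeight G o ^ n ≠ 0 := pow_ne_zero _ (minNbrWeight_ne_zero hconn o)
  have hT : minNbrWeight G o ^ n ≠ ⊤ := ENNReal.pow_ne_top (minNbrWeight_ne_top hconn ht hU o)
  rw [← ENNReal.mul_lt_mul_iff_right h0 hT]
  calc minNbrWeight G o ^ n * autWeight G o (u m)
      < minNbrWeight G o ^ m * autWeight G o (u m) :=
        ENNReal.mul_lt_mul_left (autWeight_ne_zero G hconn o (u m)) (autWeight_ne_top G hconn o (u m))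
          (minNbrWeight_pow_lt_pow hconn ht hU o hmn)
    _ = autWeight G o (u 0) := pow_mul_autWeight_upSeq hu m
    _ = minNbrWeight G o ^ n * autWeight G o (u n) := (pow_mul_autWeight_upSeq hu n).symm

/-- A down-sequence is injective. [folklore] -/
theorem injective_downSeq {G : SimpleGraph V} [G.LocallyFinite] (hconn : G.Connected)
    (ht : IsGraphTransitive G) (hU : ¬ IsGraphUnimodular G) {o : V} {u : ℕ → V}
    (hu : ∀ n, G.Adj (u n) (u (n + 1)) ∧
      autWeight G o (u (n + 1)) = minNbrWeight G o * autWeight G o (u n)) :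
    Function.Injective u := by
  intro m n h
  rcases lt_trichotomy m n with hlt | rfl | hgt
  · exact absurd (h ▸ autWeight_downSeq_lt hconn ht hU hu hlt) (lt_irrefl _)
  · rfl
  · exact absurd (h ▸ autWeight_downSeq_lt hconn ht hU hu hgt) (lt_irrefl _)

/-- An up-sequence is injective. [folklore] -/
theorem injective_upSeq {G : SimpleGraph V} [G.LocallyFinite] (hconn : G.Connected)
    (ht : IsGraphTransitive G) (hU : ¬ IsGraphUnimodular G) {o : V} {u : ℕ → V}
    (hu : ∀ n, G.Adj (u n) (u (n + 1)) ∧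
      minNbrWeight G o * autWeight G o (u (n + 1)) = autWeight G o (u n)) :
    Function.Injective u := by
  intro m n h
  rcases lt_trichotomy m n with hlt | rfl | hgt
  · exact absurd (h ▸ autWeight_upSeq_lt hconn ht hU hu hlt) (lt_irrefl _)
  · rfl
  · exact absurd (h ▸ autWeight_upSeq_lt hconn ht hU hu hgt) (lt_irrefl _)

/-- **A down-sequence goes below every positive weight.** [cite: Timar2006, §5 (proof of Lemma 5.2: reaching lower levels)] -/
theorem exists_autWeight_downSeq_lt {G : SimpleGraph V} [G.LocallyFinite] (hconn : G.Connected)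
    (ht : IsGraphTransitive G) (hU : ¬ IsGraphUnimodular G) {o : V} {u : ℕ → V}
    (hu : ∀ n, G.Adj (u n) (u (n + 1)) ∧
      autWeight G o (u (n + 1)) = minNbrWeight G o * autWeight G o (u n)) {t : ℝ≥0∞} (ht0 : t ≠ 0) :
    ∃ n, autWeight G o (u n) < t := by
  have hlim : Tendsto (fun n : ℕ => minNbrWeight G o ^ n * autWeight G o (u 0)) atTop (nhds 0) := by
    have h0 : Tendsto (fun n : ℕ => minNbrWeight G o ^ n) atTop (nhds 0) :=
      ENNReal.tendsto_pow_atTop_nhds_zero_of_lt_one (minNbrWeight_lt_one hconn ht hU o)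
    simpa using ENNReal.Tendsto.mul_const h0 (Or.inr (autWeight_ne_top G hconn o (u 0)))
  obtain ⟨n, hn⟩ := (hlim.eventually (gt_mem_nhds (pos_iff_ne_zero.2 ht0))).exists
  exact ⟨n, (autWeight_downSeq hu n).trans_lt hn⟩

/-- **An up-sequence goes above every finite weight.** [cite: Timar2006, §5 (proof of Lemma 5.2: reaching higher levels)] -/
theorem exists_lt_autWeight_upSeq {G : SimpleGraph V} [G.LocallyFinite] (hconn : G.Connected)
    (ht : IsGraphTransitive G) (hU : ¬ IsGraphUnimodular G) {o : V} {u : ℕ → V}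
    (hu : ∀ n, G.Adj (u n) (u (n + 1)) ∧
      minNbrWeight G o * autWeight G o (u (n + 1)) = autWeight G o (u n)) {t : ℝ≥0∞} (htT : t ≠ ⊤) :
    ∃ n, t < autWeight G o (u n) := by
  -- `Δ^n t → 0 < w(u 0) = Δ^n w(u n)`
  have hlim : Tendsto (fun n : ℕ => minNbrWeight G o ^ n * t) atTop (nhds 0) := by
    have h0 : Tendsto (fun n : ℕ => minNbrWeight G o ^ n) atTop (nhds 0) :=
      ENNReal.tendsto_pow_atTop_nhds_zero_of_lt_one (minNbrWeight_lt_one hconn ht hU o)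
    simpa using ENNReal.Tendsto.mul_const h0 (Or.inr htT)
  obtain ⟨n, hn⟩ :=
    (hlim.eventually (gt_mem_nhds (pos_iff_ne_zero.2 (autWeight_ne_zero G hconn o (u 0))))).exists
  refine ⟨n, ?_⟩
  have h0 : minNbrWeight G o ^ n ≠ 0 := pow_ne_zero _ (minNbrWeight_ne_zero hconn o)
  have hT : minNbrWeight G o ^ n ≠ ⊤ := ENNReal.pow_ne_top (minNbrWeight_ne_top hconn ht hU o)
  rw [← ENNReal.mul_lt_mul_iff_right h0 hT, pow_mul_autWeight_upSeq hu n]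
  exact hn

/-! ### Bookkeeping for total weights -/

/-- The total weight is monotone in the set. [folklore] -/
theorem setWeight_mono (G : SimpleGraph V) (o : V) {C D : Set V} (h : C ⊆ D) :
    setWeight G o C ≤ setWeight G o D :=
  ENNReal.tsum_le_tsum fun v => Set.indicator_le_indicator_of_subset h (fun _ => bot_le) v

/-- A superset of a heavy set is heavy. [folklore] -/
theorem IsHeavy.mono {G : SimpleGraph V} {o : V} {C D : Set V} (hC : IsHeavy G o C) (h : C ⊆ D) :
    IsHeavy G o D :=
  eq_top_iff.2 (hC ▸ setWeight_mono G o h)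

/-- A subset of a light set is light. [folklore] -/
theorem not_isHeavy_of_subset {G : SimpleGraph V} {o : V} {C D : Set V} (hD : ¬ IsHeavy G o D)
    (h : C ⊆ D) : ¬ IsHeavy G o C :=
  fun hC => hD (hC.mono h)

/-- The total weight is finitely subadditive: `W(C ∪ D) ≤ W(C) + W(D)`. [folklore] -/
theorem setWeight_union_le (G : SimpleGraph V) (o : V) (C D : Set V) :
    setWeight G o (C ∪ D) ≤ setWeight G o C + setWeight G o D := by
  rw [setWeight, setWeight, setWeight, ← ENNReal.tsum_add]
  refine ENNReal.tsum_le_tsum fun v => ?_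
  by_cases hC : v ∈ C
  · rw [Set.indicator_of_mem (Set.mem_union_left D hC), Set.indicator_of_mem hC]
    exact le_self_add
  · by_cases hD : v ∈ D
    · rw [Set.indicator_of_mem (Set.mem_union_right C hD), Set.indicator_of_notMem hC,
        Set.indicator_of_mem hD, zero_add]
    · rw [Set.indicator_of_notMem (fun h => h.elim hC hD)]
      exact bot_le

/-- A union of two sets is heavy iff one of them is. [folklore] -/
theorem isHeavy_union_iff {G : SimpleGraph V} {o : V} {C D : Set V} :
    IsHeavy G o (C ∪ D) ↔ IsHeavy G o C ∨ IsHeavy G o D := by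
  constructor
  · intro h
    by_contra hno
    rw [not_or] at hno
    have hle := setWeight_union_le G o C D
    rw [show setWeight G o (C ∪ D) = ⊤ from h, top_le_iff] at hle
    exact ENNReal.add_ne_top.2 ⟨hno.1, hno.2⟩ hle
  · rintro (h | h)
    · exact h.mono Set.subset_union_left
    · exact h.mono Set.subset_union_right

/-- The total weight is countably subadditive over indexed unions. [folklore] -/
theorem setWeight_iUnion_le {ι : Type*} [Countable ι] (G : SimpleGraph V) (o : V) (D : ι → Set V) :
    setWeight G o (⋃ i, D i) ≤ ∑' i, setWeight G o (D i) := by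
  rw [setWeight]
  calc ∑' v, (⋃ i, D i).indicator (autWeight G o) v
      ≤ ∑' v, ∑' i, (D i).indicator (autWeight G o) v := by
        refine ENNReal.tsum_le_tsum fun v => ?_
        by_cases hv : v ∈ ⋃ i, D i
        · obtain ⟨i, hi⟩ := Set.mem_iUnion.1 hv
          rw [Set.indicator_of_mem hv]
          calc autWeight G o v = (D i).indicator (autWeight G o) v := (Set.indicator_of_mem hi _).symm
            _ ≤ ∑' j, (D j).indicator (autWeight G o) v := ENNReal.le_tsum i
        · rw [Set.indicator_of_notMem hv]
          exact bot_le
    _ = ∑' i, setWeight G o (D i) := by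
        rw [ENNReal.tsum_comm]
        rfl

/-- **A heavy set covered by a finite set and finitely many further sets has a heavy piece**: if
`C ⊆ K ∪ ⋃_{i ∈ s} D i` with `K` finite and `C` heavy, some `C ∩ D i` (`i ∈ s`) is heavy
(connected, locally finite `G`). [folklore] -/
theorem IsHeavy.exists_isHeavy_inter {G : SimpleGraph V} [G.LocallyFinite] (hconn : G.Connected)
    {o : V} {C K : Set V} (hC : IsHeavy G o C) (hK : K.Finite) {ι : Type*} (s : Finset ι)
    (D : ι → Set V) (hcov : C ⊆ K ∪ ⋃ i ∈ s, D i) : ∃ i ∈ s, IsHeavy G o (C ∩ D i) := by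
  classical
  by_contra hno
  push Not at hno
  have hsplit : C ⊆ (C ∩ K) ∪ ⋃ i : s, C ∩ D i := by
    intro v hv
    rcases hcov hv with h | h
    · exact Or.inl ⟨hv, h⟩
    · obtain ⟨i, hi, hvi⟩ := Set.mem_iUnion₂.1 h
      exact Or.inr (Set.mem_iUnion.2 ⟨⟨i, hi⟩, hv, hvi⟩)
  have h1 : setWeight G o (C ∩ K) ≠ ⊤ :=
    not_isHeavy_of_finite G hconn o (hK.subset Set.inter_subset_right)
  have h2 : setWeight G o (⋃ i : s, C ∩ D i) ≠ ⊤ := by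
    refine ne_top_of_le_ne_top ?_ (setWeight_iUnion_le G o _)
    rw [tsum_fintype]
    exact ENNReal.sum_ne_top.2 fun i _ => hno i i.2
  have hC' : setWeight G o C = ⊤ := hC
  have htop : setWeight G o ((C ∩ K) ∪ ⋃ i : s, C ∩ D i) = ⊤ :=
    eq_top_iff.2 (hC' ▸ setWeight_mono G o hsplit)
  refine ENNReal.add_ne_top.2 ⟨h1, h2⟩ (eq_top_iff.2 ?_)
  exact htop ▸ setWeight_union_le G o _ _

end Literature.Barriers.CriticalPhenomena

end
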